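import Literature.Topology.FourManifolds.HCobordismWallConnectedSumProofs
import Literature.Topology.FourManifolds.HCobordismWallDegreeTwo
import Literature.Topology.FourManifolds.CobordismAttachmentHomology
import Literature.Topology.FourManifolds.CobordismOfAttachment
import Literature.Topology.FourManifolds.CobordismAttachmentProofs
import Literature.Topology.FourManifolds.KroneckerFreeCohomology
import Literature.Topology.FourManifolds.LatticeDualityAnnihilator
import Literature.Topology.FourManifolds.LatticeDualityAdjoint
import Literature.Topology.FourManifolds.WallHandlebodyEpi
import Literature.Topology.FourManifolds.WallHandlebodySimplyConnected
import Literature.Topology.FourManifolds.WallHandlebodyBoundaryProofs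
import Literature.Topology.FourManifolds.WallBoundingHandlebody
import Literature.Topology.FourManifolds.HCobordismFreedman
import Literature.Topology.FourManifolds.HCobordismDonaldson
import HarnessLib

/-!
# Wall's Theorem 2 along its printed proof: the re-gluing of `R` and the final assembly — PROVED
# from Thm. 1, Lemma 2, the realisation of automorphs on `∂V`, and the merging cobordism

Topic `Literature/Topology/FourManifolds`; in the cone of the named fact
`Literature.Topology.FourManifolds.isHCobordant_of_equivalent_intersectionForm` (**Wall 1964,
Thm. 2**: closed smooth simply connected 4-manifolds with isometric intersection forms are
h-cobordant; C. T. C. Wall, *On simply-connected 4-manifolds*, J. London Math. Soc. 39 (1964)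
141–149; `HCobordismDonaldson.lean`).

Wall's proof (§2, pp. 144–146): `N = M₁ # (−M₂)` has signature `0`; by Thm. 1 it bounds `W⁵`
1-connected of the homotopy type of a bouquet of 2-spheres; by Lemma 2, `W ⊇ V ∈ ℋ(5, k, 2)`
(one `0`-handle, `k` `2`-handles) and `C = closure (W − V)` is an h-cobordism `N ∼ ∂V`; the graph
`K ⊆ H₂(N) ≅ H₂(∂V)` of the isometry `α` and `L = ker (H₂(∂V) → H₂(V))` are Lagrangian direct
summands of half rank, an automorph carries `L` to `K`, and "by the result quoted above ([11],
Cor. to Thm. 2, via [10]) there is a diffeomorphism of `∂V` which induces this isomorphism"; glue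
`R = C ∪_{∂V} V ∪ (D⁴ × I)` (attach `V` along the twisted identification, fill in the neck); then
"it is clear from construction that `R` is simply-connected … `H₂(Mᵢ) → H₂(R)` are isomorphisms …
Hence `Hₖ(R, Mᵢ) = 0` for `k ≤ 2` … and `R` is indeed an h-cobordism".

This file PROVES the whole of §2 after its first two sentences — the RE-GLUING and the COMPUTATION —
from four inputs taken as explicit hypotheses of the final theorem (no named fact is introduced):

* `hT1` — **Wall's Thm. 1** (no tree statement): a closed smooth simply connected 4-manifold
  with a `ℤ`-orientation of signature `0` bounds a compact simply connected `W⁵` with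
  `Hₖ(W) = 0` for `k ≥ 3` and `H₂(W)` finitely generated free — verbatim the hypotheses of the
  tree's Lemma 2;
* `hL2` — **Wall's Lemma 2**, the tree's named fact `exists_handlebody_isHCobordant_boundary`
  (`WallBoundingHandlebody.lean`);
* `hreal` — **"the result quoted above"**: for `V ∈ ℋ(5, k, 2)` every automorph of the
  intersection form of `∂V` is realised by a diffeomorphism ([10]: `∂V ≅ #ᵏ(S² × S², S² ×~ S²)`,
  with [11], Wall, *Diffeomorphisms of 4-manifolds*, Cor. to Thm. 2; the tree's
  `exists_diffeomorph_freeCohomologyMap_eq_of_isometryEquiv` is the Kirby X.2 form of [11], which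
  does not cover `∂V = S² ×~ S²` alone, whence the hypothesis is kept in Wall's own form);
* `hmerge` — **the neck-filling / merging cobordism** `W₀ = (M₁ × I) ♮ (M₂ × I)` from
  `N = M₁ # M₂` to `M₁ ⊔ M₂` WITH its homology (simply connected; `H₂(N) → H₂(W₀)` onto; the
  bottom copies `Mᵢ → W₀` induce on `H₂` the summand inclusions of `H₂(N) ≅ H₂(M₁) ⊕ H₂(M₂)`
  followed by `H₂(N) → H₂(W₀)`), for SMOOTH gluing data of `N` (smooth discs and gluing maps, as
  produced by `exists_isOrientedConnectedSum_holds`), to be discharged from the tree's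
  boundary-connected-sum construction (`BordismMerging.lean`).

What is proved here (everything else being tree theorems landed for this purpose:
`CobordismAttachmentSimplyConnected/Homology`, `CobordismOfAttachment`, `HCobordismWallDegreeTwo`,
`KroneckerFreeCohomology`, `LatticeDualityAnnihilator/Adjoint`, `WallHandlebodyEpi/SimplyConnected`,
`HCobordismWallConnectedSum(Proofs)`, `ConnectedSumCohomology`, `WallHandlebodyBoundary(Proofs)`,
`LatticeFormsLagrangian`):

* `exists_regluing_cobordism` — **the re-gluing** (pp. 145–146): from a compact simply
  connected `V⁵` with `H₂(∂V) → H₂(V)` onto, an h-cobordism `C` from `N` to `∂V`, a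
  self-diffeomorphism `g` of `∂V` and a cobordism `W₀` from `N` to `M₁ ⊔ M₂` with simply connected
  total space: a cobordism `R` from `M₁` to `M₂` (the attachment `(V ∪_g C) ∪_N W₀`,
  `exists_cobordismAttachment_holds` twice, `CobordismAttachment.toCobordismOfSum`) which is
  SIMPLY CONNECTED (van Kampen twice, `CobordismAttachment.simplyConnectedSpace`), onto whose `H₂`
  the piece `W₀` surjects (Mayer–Vietoris twice, `CobordismAttachment.epi_map_jX_of_epi`), whose
  ends factor through `W₀`, and in which every class `Φ(g_* y)`, `y ∈ L = ker (H₂(∂V) → H₂(V))`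
  (`Φ : H₂(∂V) ≅ H₂(N)` through `C`), dies.
* `surjective_comp_of_wall_lattice_data` — **the computation** (p. 146, "Now we calculate what
  has happened to the second homology group … the induced maps `H₂(M₁) → H₂(R)` and
  `H₂(M₂) → H₂(R)` are [onto]"), as PURE ALGEBRA across the Kronecker pairings: Wall's
  cohomological condition `g^*(K') = L` forces the homological graph of `−α†` to die in `R`
  (`LatticeDualityAnnihilator`), and a graph of an isomorphism is complementary to both summands
  (`HCobordismWallConnectedSumProofs`, §GraphQuotient).
* `isHCobordant_of_equivalent_intersectionForm_of_constructions` — **Thm. 2 from the four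
  inputs**: `hT1 → hL2 → hreal → hmerge → isHCobordant_of_equivalent_intersectionForm`, ending in
  the recognition theorem `isHCobordant_of_epi_singularHomologyMap_two` ("Hence … h-cobordism").
  It is the universal closure of the pointwise `isHCobordant_of_constructions_pair`, in which
  Thm. 1 enters only for `N` of lattice rank `rank H²(M₁)/T + rank H²(M₂)/T` (that of
  `M₁ # (−M₂)`), whence also `isHCobordant_of_constructions_of_finrank_ne_one` — **Thm. 2 for
  `rank ≠ 1` from Thm. 1 for rank `≠ 2`**, the af-cyclic first stage of Wall's own order of proof
  (Thm. 1 for rank `2` is proved on p. 146 through Thm. 2 for rank `≠ 1`).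

## References

* C. T. C. Wall, *On simply-connected 4-manifolds*, J. London Math. Soc. 39 (1964) 141–149,
  Thm. 2 and §2 pp. 144–146. [WallJLMS1964]
* J. Milnor, *Lectures on the h-cobordism theorem*, Princeton (1965), §1 Thm. 1.4.
  [MilnorHCobordism1965]
* A. Hatcher, *Algebraic Topology*, CUP (2002), §2.2 (Mayer–Vietoris), §3.1 (Kronecker pairing,
  universal coefficients), Lemma 1.15. [HatcherAT2002]
* R. C. Kirby, *The topology of 4-manifolds*, LNM 1374 (1989), Ch. X Thm. 2. [Kirby1989]
-/

open scoped Manifold ContDiff Topology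
open Set Function Module CategoryTheory CategoryTheory.Limits
open Literature.AlgebraicTopology.SingularHomology Literature.AlgebraicTopology.Homotopy

noncomputable section

namespace Literature.Topology.FourManifolds

/-- Local notation: `𝔼 n` is the model Euclidean space `EuclideanSpace ℝ (Fin n)`. -/
local notation "𝔼 " n:arg => EuclideanSpace ℝ (Fin n)

/-- Local notation: `Q⟦μ⟧` is the intersection form on `H²(M; ℤ)/T` of the closed `ℤ`-oriented
topological 4-manifold `(M, μ)` (as in `HCobordismDonaldson.lean`). -/
local notation "Q⟦" μ "⟧" =>
  Literature.AlgebraicTopology.SingularHomology.intersectionForm two_add_two_eq_four μ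

/-! ### The computation of `H₂(R)`: pure algebra across the Kronecker pairings -/

section Algebra

variable {C₁ C₂ Wc Cd CH H₁ H₂ Wh Hd HH X : Type*}
  [AddCommGroup C₁] [Module ℤ C₁] [AddCommGroup C₂] [Module ℤ C₂] [AddCommGroup Wc] [Module ℤ Wc]
  [AddCommGroup Cd] [Module ℤ Cd] [AddCommGroup CH] [Module ℤ CH]
  [AddCommGroup H₁] [Module ℤ H₁] [AddCommGroup H₂] [Module ℤ H₂] [AddCommGroup Wh] [Module ℤ Wh]
  [AddCommGroup Hd] [Module ℤ Hd] [AddCommGroup HH] [Module ℤ HH] [Module.Projective ℤ HH]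
  [AddCommGroup X] [Module ℤ X]

/-- **Wall's computation of `H₂(Mᵢ) → H₂(R)`** (1964, p. 146: "If we attach `V`, the kernel of
`H₂(∂V) → H₂(V)` is `L = K`, the set of pairs `(x, y)` … with `αx = y`. Since `K` is disjoint from
`H₂(M₁)`, `H₂(M₂)`, we see that the induced maps `H₂(M₁) → H₂(R)` and `H₂(M₂) → H₂(R)` are
[onto]"), as algebra across Kronecker-type pairings. DATA: cohomology lattices `C₁, C₂`
(of `M₁, M₂`), `W_c` (of `N`), `C_∂` (of `∂V`), `C_H` (of `V`) and homology lattices `H₁, H₂,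
W_h, H_∂, H_H` (`H_H` projective), pairings `κ` (perfect on the closed manifolds, onto for `V`);
the connected-sum splitting `c_M^*, c_N^*, s_M, s_N` of `W_c` with its homological adjoints
`s_h, t_h`; a bijective `α : C₁ → C₂`; the transport `Φ_c : W_c → C_∂`, `Φ_h : H_∂ ≅ W_h` through
the h-cobordism (adjoint); the diffeomorphism `g` through `g^* = g_c`, `g_* = g_h` (adjoint,
`g_c` one-to-one); the handlebody through `ι_* = ι_h` (onto) and `ι^* = ι_c` (adjoint); WALL'S
CONDITION `g^*(Φ_c(K)) = im ι^*` for the graph `K` of `α`; a linear `F : W_h → X` (`H₂(N) → H₂(R)`)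
which is onto and kills `Φ_h (g_h y)` for `y ∈ ker ι_h`; and summand inclusions `i₁, i₂`.
CONCLUSION: `F ∘ i₁` and `F ∘ i₂` are onto. PROOF: the homological graph of `−α†`
(`exists_adjoint_bijective`) lies in `ker (ι_h ∘ g_h⁻¹ ∘ Φ_h⁻¹) ⊆ ker F`
(`graphSubmodule_le_ker_of_forall`, the annihilator of that kernel lying in `K` by
`mem_range_iff_forall_mem_ker_pairing_eq_zero` and Wall's condition), the homological splitting
is a splitting (`bijective_transpose_of_bijective`), and a graph of an isomorphism is
complementary to both summands (`surjective_comp_inr/inl_of_graphSubmodule_le_ker`).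
[cite: WallJLMS1964, §2 p. 146] -/
theorem surjective_comp_of_wall_lattice_data
    (κN : Wc →ₗ[ℤ] Wh →ₗ[ℤ] ℤ) [κN.IsPerfPair] (κ₁ : C₁ →ₗ[ℤ] H₁ →ₗ[ℤ] ℤ) [κ₁.IsPerfPair]
    (κ₂ : C₂ →ₗ[ℤ] H₂ →ₗ[ℤ] ℤ) [κ₂.IsPerfPair] (κd : Cd →ₗ[ℤ] Hd →ₗ[ℤ] ℤ) [κd.IsPerfPair]
    (κH : CH →ₗ[ℤ] HH →ₗ[ℤ] ℤ) (hκH : Surjective κH)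
    -- the connected-sum splitting and its homological transpose
    {cMc : C₁ →ₗ[ℤ] Wc} {cNc : C₂ →ₗ[ℤ] Wc} {sM : Wc →ₗ[ℤ] C₁} {sN : Wc →ₗ[ℤ] C₂}
    {sh : Wh →ₗ[ℤ] H₁} {th : Wh →ₗ[ℤ] H₂}
    (hadjM : ∀ a x, κN (cMc a) x = κ₁ a (sh x)) (hadjN : ∀ b x, κN (cNc b) x = κ₂ b (th x))
    (h1 : ∀ w, cMc (sM w) + cNc (sN w) = w) (h2 : ∀ a b, sM (cMc a + cNc b) = a)
    (h3 : ∀ a b, sN (cMc a + cNc b) = b)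
    -- the isometry
    {α : C₁ →ₗ[ℤ] C₂} (hα : Bijective α)
    -- the h-cobordism
    {Φc : Wc →ₗ[ℤ] Cd} {Φh : Hd →ₗ[ℤ] Wh} {Ψh : Wh →ₗ[ℤ] Hd}
    (hΦ : ∀ w y, κN w (Φh y) = κd (Φc w) y) (hΦc : Injective Φc)
    (hΦΨ : ∀ x, Φh (Ψh x) = x) (hΨΦ : ∀ y, Ψh (Φh y) = y)
    -- the diffeomorphism
    {gc : Cd →ₗ[ℤ] Cd} {gh gh' : Hd →ₗ[ℤ] Hd} (hg : ∀ a y, κd (gc a) y = κd a (gh y))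
    (hgc : Injective gc) (hgg' : ∀ y, gh (gh' y) = y) (hg'g : ∀ y, gh' (gh y) = y)
    -- the handlebody
    {ιh : Hd →ₗ[ℤ] HH} (hιh : Surjective ιh) {ιc : CH →ₗ[ℤ] Cd}
    (hι : ∀ b y, κd (ιc b) y = κH b (ιh y))
    -- Wall's condition `g^*(Φ_c(K)) = L = im ι^*`
    (hWall : ((graphSubmodule sM sN α).map Φc).map gc = LinearMap.range ιc)
    -- the geometric map `H₂(N) → H₂(R)`
    {F : Wh →ₗ[ℤ] X} (hF : Surjective F) (hvan : ∀ y, ιh y = 0 → F (Φh (gh y)) = 0)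
    -- the summand inclusions
    {i₁ : H₁ →ₗ[ℤ] Wh} (hi₁s : ∀ z, sh (i₁ z) = z) (hi₁t : ∀ z, th (i₁ z) = 0)
    {i₂ : H₂ →ₗ[ℤ] Wh} (hi₂s : ∀ z, sh (i₂ z) = 0) (hi₂t : ∀ z, th (i₂ z) = z) :
    Surjective (F ∘ₗ i₁) ∧ Surjective (F ∘ₗ i₂) := by
  -- (1) the homological splitting is a splitting
  have hc : Bijective fun ab : C₁ × C₂ => cMc ab.1 + cNc ab.2 := by
    refine ⟨fun ab ab' h => ?_, fun w => ⟨(sM w, sN w), h1 w⟩⟩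
    have ha := congrArg sM h
    have hb := congrArg sN h
    simp only [h2, h3] at ha hb
    exact Prod.ext ha hb
  have hst : Bijective fun x : Wh => (sh x, th x) :=
    bijective_transpose_of_bijective κN κ₁ κ₂ hadjM hadjN hc
  have hts : Bijective fun x : Wh => (th x, sh x) :=
    (Equiv.prodComm H₁ H₂).bijective.comp hst
  -- (2) the adjoint `α†` of `α`, a bijection `H₂ → H₁`
  obtain ⟨β, hβ, hαβ⟩ := exists_adjoint_bijective κ₁ κ₂ hα
  have hβ' : Bijective (-β) := by
    refine ⟨fun x y h => hβ.1 (neg_injective ?_), fun z => ?_⟩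
    · simpa using h
    · obtain ⟨y, hy⟩ := hβ.2 (-z)
      exact ⟨y, by simp [hy]⟩
  -- (3) the decomposition of `κN` along the splitting
  have hκ : ∀ w x, κN w x = κ₁ (sM w) (sh x) + κ₂ (sN w) (th x) := fun w x => by
    conv_lhs => rw [← h1 w]
    rw [map_add, LinearMap.add_apply, hadjM, hadjN]
  -- (4) the kernel `D = Φ_h (g_h (ker ι_h)) = ker (ι_h ∘ g_h⁻¹ ∘ Φ_h⁻¹)`
  let πH : Wh →ₗ[ℤ] HH := ιh ∘ₗ gh' ∘ₗ Ψh
  have hπH : ∀ x, x ∈ LinearMap.ker πH ↔ ιh (gh' (Ψh x)) = 0 := fun x => by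
    rw [LinearMap.mem_ker]; rfl
  -- (5) Wall's condition: every `a ∈ W_c` killing `ker πH` lies in the graph `K`
  have hK : ∀ a : Wc, (∀ d ∈ LinearMap.ker πH, κN a d = 0) →
      a ∈ graphSubmodule sM sN α := by
    intro a ha
    -- `g^*(Φ_c a)` kills `ker ι_h`, hence lies in `im ι^* = g^*(Φ_c(K))`
    have hmem : gc (Φc a) ∈ LinearMap.range ιc := by
      rw [mem_range_iff_forall_mem_ker_pairing_eq_zero κd κH hιh hι
        (LinearMap.IsPerfPair.bijective_left κd).1 hκH]
      intro y hy
      have hd : Φh (gh y) ∈ LinearMap.ker πH := by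
        rw [hπH, hΨΦ, hg'g]
        exact LinearMap.mem_ker.1 hy
      have h0 := ha _ hd
      rwa [hΦ, ← hg] at h0
    rw [← hWall] at hmem
    obtain ⟨_, ⟨k, hk, rfl⟩, hk'⟩ := hmem
    have hka : k = a := hΦc (hgc hk')
    rwa [hka] at hk
  -- (6) the homological graph of `−α†` dies under `πH`, hence under `F`
  have hgraph : graphSubmodule th sh (-β) ≤ LinearMap.ker πH :=
    graphSubmodule_le_ker_of_forall κN (LinearMap.IsPerfPair.bijective_left κN).2 κ₁ κ₂ hκ
      hαβ πH hK
  have hkerF : graphSubmodule th sh (-β) ≤ LinearMap.ker F := by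
    intro x hx
    have hxπ := hgraph hx
    rw [hπH] at hxπ
    rw [LinearMap.mem_ker]
    have hx' : x = Φh (gh (gh' (Ψh x))) := by rw [hgg', hΦΨ]
    rw [hx']
    exact hvan _ hxπ
  -- (7) the graph is complementary to both summands
  exact ⟨surjective_comp_inr_of_graphSubmodule_le_ker hts (-β) hF hkerF hi₁t hi₁s,
    surjective_comp_inl_of_graphSubmodule_le_ker hts hβ'.2 hF hkerF hi₂t hi₂s⟩

end Algebra

/-! ### The re-gluing `R = (V ∪_g C) ∪_N W₀` -/

section Regluing

variable (H : Type) [TopologicalSpace H] [T2Space H] [SecondCountableTopology H]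
  [ChartedSpace (EuclideanHalfSpace (4 + 1)) H] [IsManifold (𝓡∂ (4 + 1)) ∞ H] [CompactSpace H]
  {N : Type} [TopologicalSpace N] [ChartedSpace (𝔼 4) N] [IsManifold (𝓡 4) ∞ N] [CompactSpace N]
  {M₁ M₂ : Type} [TopologicalSpace M₁] [ChartedSpace (𝔼 4) M₁] [IsManifold (𝓡 4) ∞ M₁]
  [CompactSpace M₁] [TopologicalSpace M₂] [ChartedSpace (𝔼 4) M₂] [IsManifold (𝓡 4) ∞ M₂]
  [CompactSpace M₂]

/-- **The re-gluing of Wall's `R`** (1964, pp. 145–146: "We now take the h-cobordism of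
`M₁ # (−M₂)` to `∂V`, and 'fill in' `∂V` by attaching `V` [along the diffeomorphism inducing the
chosen automorph] … and fill in `S³ × I` by attaching `D⁴ × I`. We have now constructed a
manifold `R` whose boundary components are `M₁` and `M₂`; we claim that `R` is an h-cobordism.
First, it is clear from construction that `R` is simply-connected"). INPUT: a compact simply
connected `V⁵` (`H`) with `H₂(∂V; ℤ) → H₂(V; ℤ)` onto and `∂V` simply connected, an h-cobordism
`C` from `N` to `∂V` with `N` simply connected, a self-diffeomorphism `g` of `∂V`, and a
cobordism `W₀` from `N` to `M₁ ⊔ M₂` with simply connected total space (the neck-filling).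
OUTPUT: a cobordism `R` from `M₁` to `M₂` — `R₀ = V ∪_g C` (`exists_cobordismAttachment_holds`,
Milnor Thm. 1.4, the twist `g` being the identification `∂V ≅` incoming end of `C.symm`) and
`R = R₀ ∪_N W₀` read as a cobordism between the summands of the far end
(`CobordismAttachment.toCobordismOfSum`) — such that: `R` is simply connected (van Kampen,
`CobordismAttachment.simplyConnectedSpace`, twice); `jX_* : H₂(W₀) → H₂(R)` is onto
(Mayer–Vietoris, `CobordismAttachment.epi_map_jX_of_epi`, twice: `H₂(∂V) → H₂(V)` onto,
`H₂(N) ≅ H₂(C) → H₂(R₀)` onto); the ends of `R` are `jX ∘ inr ∘ Sum.inl/inr`; and for every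
`y ∈ ker (H₂(∂V) → H₂(V))` and `n ∈ H₂(N)` with `inl_* n = inr_* (g_* y)` in `H₂(C)` the class
`jX_* (inl_* n)` vanishes in `H₂(R)` ("If we attach `V`, the kernel of `H₂(∂V) → H₂(V)` is `L`").
[cite: WallJLMS1964, §2 pp. 145–146] [cite: MilnorHCobordism1965, §1, Thm. 1.4] -/
theorem exists_regluing_cobordism [SimplyConnectedSpace H] [SimplyConnectedSpace N]
    [SimplyConnectedSpace ((𝓡∂ (4 + 1)).boundary H)]
    (hepi : Epi (singularHomology.map ℤ ℤ
      (⟨Subtype.val, continuous_subtype_val⟩ : C(↥((𝓡∂ (4 + 1)).boundary H), H)) 2))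
    (C : Cobordism 4 N ((𝓡∂ (4 + 1)).boundary H)) (hC : C.IsHCobordism)
    (g : ((𝓡∂ (4 + 1)).boundary H) ≃ₘ⟮𝓡 4, 𝓡 4⟯ ((𝓡∂ (4 + 1)).boundary H))
    (W₀ : Cobordism 4 N (M₁ ⊕ M₂)) [SimplyConnectedSpace W₀.W] :
    ∃ (Rc : Cobordism 4 M₁ M₂) (_ : SimplyConnectedSpace Rc.W) (J : C(W₀.W, Rc.W)),
      Epi (singularHomology.map ℤ ℤ J 2) ∧
      (⟨Rc.inl, Rc.continuous_inl⟩ : C(M₁, Rc.W)) =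
        J.comp ⟨W₀.inr ∘ Sum.inl, W₀.continuous_inr.comp continuous_inl⟩ ∧
      (⟨Rc.inr, Rc.continuous_inr⟩ : C(M₂, Rc.W)) =
        J.comp ⟨W₀.inr ∘ Sum.inr, W₀.continuous_inr.comp continuous_inr⟩ ∧
      ∀ (y : singularHomology ℤ ℤ ((𝓡∂ (4 + 1)).boundary H) 2) (n : singularHomology ℤ ℤ N 2),
        singularHomology.map ℤ ℤ
            (⟨Subtype.val, continuous_subtype_val⟩ : C(↥((𝓡∂ (4 + 1)).boundary H), H)) 2 y = 0 →
        singularHomology.map ℤ ℤ (⟨C.inl, C.continuous_inl⟩ : C(N, C.W)) 2 n =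
          singularHomology.map ℤ ℤ (⟨C.inr, C.continuous_inr⟩ : C(↥((𝓡∂ (4 + 1)).boundary H), C.W)) 2
            (singularHomology.map ℤ ℤ (⟨g, g.continuous⟩ : C(↥((𝓡∂ (4 + 1)).boundary H), ↥((𝓡∂ (4 + 1)).boundary H))) 2 y) →
        singularHomology.map ℤ ℤ J 2
          (singularHomology.map ℤ ℤ (⟨W₀.inl, W₀.continuous_inl⟩ : C(N, W₀.W)) 2 n) = 0 := by
  haveI : CompactSpace ((𝓡∂ (4 + 1)).boundary H) := compactSpace_boundary 4 H
  -- the h-cobordism reversed: from `∂V` to `N`, simply connected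
  set C' : Cobordism 4 ((𝓡∂ (4 + 1)).boundary H) N := C.symm with hC'
  haveI : SimplyConnectedSpace C.W := hC.simplyConnectedSpace
  haveI : SimplyConnectedSpace C'.W := ‹SimplyConnectedSpace C.W›
  -- `R₀ = V ∪_g C'`
  obtain ⟨R₀, i1, i2, i3, i4, i5, ⟨At₀⟩⟩ := exists_cobordismAttachment_holds 3 H (BoundaryManifold.boundaryData 4 H)
    ((𝓡∂ (4 + 1)).boundary H) N C' g
  haveI := At₀.compactSpace
  haveI : SimplyConnectedSpace R₀ := At₀.simplyConnectedSpace
  have h1d : IsZero (singularHomology ℤ ℤ ((𝓡∂ (4 + 1)).boundary H) 1) :=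
    isZero_singularHomology_one_of_simplyConnectedSpace ℤ ℤ
  haveI : Epi (singularHomology.map ℤ ℤ (BoundaryManifold.boundaryData 4 H).inclC (1 + 1)) := hepi
  have hepi₀ : Epi (singularHomology.map ℤ ℤ At₀.jXC (1 + 1)) := At₀.epi_map_jX_of_epi ℤ ℤ h1d
  -- `R = R₀ ∪_N W₀`
  obtain ⟨R, j1, j2, j3, j4, j5, ⟨At⟩⟩ := exists_cobordismAttachment_holds 3 R₀ At₀.boundaryData
    N (M₁ ⊕ M₂) W₀ (Diffeomorph.refl (𝓡 4) N ∞)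
  haveI := At.compactSpace
  haveI : SimplyConnectedSpace R := At.simplyConnectedSpace
  have h1N : IsZero (singularHomology ℤ ℤ N 1) := isZero_singularHomology_one_of_simplyConnectedSpace ℤ ℤ
  -- `H₂(N) → H₂(R₀)` (the boundary inclusion of `R₀`) is onto: `N ≅ H₂(C) ↠ H₂(R₀)`
  have hmapfac : singularHomology.map ℤ ℤ At₀.boundaryData.inclC (1 + 1) =
      singularHomology.map ℤ ℤ (⟨C.inl, C.continuous_inl⟩ : C(N, C.W)) (1 + 1) ≫
        singularHomology.map ℤ ℤ At₀.jXC (1 + 1) :=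
    singularHomology.map_comp ℤ ℤ (⟨C.inl, C.continuous_inl⟩ : C(N, C.W)) At₀.jXC (1 + 1)
  have hEpi₁ : Epi (singularHomology.map ℤ ℤ (⟨C.inl, C.continuous_inl⟩ : C(N, C.W)) (1 + 1)) :=
    @IsIso.epi_of_iso _ _ _ _ _ (hC.isIso_map_inl (1 + 1))
  haveI : Epi (singularHomology.map ℤ ℤ At₀.boundaryData.inclC (1 + 1)) :=
    hmapfac ▸ @epi_comp _ _ _ _ _ _ hEpi₁ _ hepi₀
  have hepiJ : Epi (singularHomology.map ℤ ℤ At.jXC (1 + 1)) := At.epi_map_jX_of_epi ℤ ℤ h1N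
  -- the cobordism `R` from `M₁` to `M₂`
  refine ⟨At.toCobordismOfSum, ‹SimplyConnectedSpace R›, At.jXC, hepiJ, rfl, rfl, ?_⟩
  -- the vanishing: `jX_* (inl₀_* n) = jW_* (jX₀_* (C.inl_* n)) = jW_* (jX₀_* (C.inr_* (g_* y)))`
  --   `= jW_* (jH_* (val_* y)) = 0`
  intro y n hy hn
  have hseam : (At.jXC.comp (⟨W₀.inl, W₀.continuous_inl⟩ : C(N, W₀.W))) =
      (At.jWC.comp (At₀.jXC.comp (⟨C.inl, C.continuous_inl⟩ : C(N, C.W)))) := by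
    ext x
    exact (At.jW_incl x).symm
  have hseam₀ : (At₀.jXC.comp ((⟨C.inr, C.continuous_inr⟩ : C(↥((𝓡∂ (4 + 1)).boundary H), C.W)).comp
      (⟨g, g.continuous⟩ : C(↥((𝓡∂ (4 + 1)).boundary H), ↥((𝓡∂ (4 + 1)).boundary H))))) =
      At₀.jWC.comp (⟨Subtype.val, continuous_subtype_val⟩ : C(↥((𝓡∂ (4 + 1)).boundary H), H)) := by
    ext z
    exact (At₀.jW_incl z).symm
  have e1 : singularHomology.map ℤ ℤ At.jXC 2
      (singularHomology.map ℤ ℤ (⟨W₀.inl, W₀.continuous_inl⟩ : C(N, W₀.W)) 2 n) =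
      singularHomology.map ℤ ℤ At.jWC 2 (singularHomology.map ℤ ℤ At₀.jXC 2
        (singularHomology.map ℤ ℤ (⟨C.inl, C.continuous_inl⟩ : C(N, C.W)) 2 n)) := by
    have h := congrArg (fun φ : C(N, R) => singularHomology.map ℤ ℤ φ 2 n) hseam
    simp only [singularHomology.map_comp, ModuleCat.comp_apply] at h
    exact h
  have e2 : singularHomology.map ℤ ℤ At₀.jXC 2
      (singularHomology.map ℤ ℤ (⟨C.inr, C.continuous_inr⟩ : C(↥((𝓡∂ (4 + 1)).boundary H), C.W)) 2
        (singularHomology.map ℤ ℤ (⟨g, g.continuous⟩ : C(↥((𝓡∂ (4 + 1)).boundary H), ↥((𝓡∂ (4 + 1)).boundary H))) 2 y)) =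
      singularHomology.map ℤ ℤ At₀.jWC 2 (singularHomology.map ℤ ℤ
        (⟨Subtype.val, continuous_subtype_val⟩ : C(↥((𝓡∂ (4 + 1)).boundary H), H)) 2 y) := by
    have h := congrArg (fun φ : C(↥((𝓡∂ (4 + 1)).boundary H), R₀) =>
      singularHomology.map ℤ ℤ φ 2 y) hseam₀
    simp only [singularHomology.map_comp, ModuleCat.comp_apply] at h
    have hsplit : singularHomology.map ℤ ℤ
        ((⟨C.inr, C.continuous_inr⟩ : C(↥((𝓡∂ (4 + 1)).boundary H), C.W)).comp (⟨g, g.continuous⟩ : C(↥((𝓡∂ (4 + 1)).boundary H), ↥((𝓡∂ (4 + 1)).boundary H)))) 2 y =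
        singularHomology.map ℤ ℤ (⟨C.inr, C.continuous_inr⟩ : C(↥((𝓡∂ (4 + 1)).boundary H), C.W)) 2
          (singularHomology.map ℤ ℤ (⟨g, g.continuous⟩ : C(↥((𝓡∂ (4 + 1)).boundary H), ↥((𝓡∂ (4 + 1)).boundary H))) 2 y) := by
      rw [singularHomology.map_comp, ModuleCat.comp_apply]
    first
      | exact h
      | exact hsplit ▸ h
  calc _ = singularHomology.map ℤ ℤ At.jWC 2 (singularHomology.map ℤ ℤ At₀.jXC 2
          (singularHomology.map ℤ ℤ (⟨C.inl, C.continuous_inl⟩ : C(N, C.W)) 2 n)) := e1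
    _ = singularHomology.map ℤ ℤ At.jWC 2 (singularHomology.map ℤ ℤ At₀.jXC 2
          (singularHomology.map ℤ ℤ (⟨C.inr, C.continuous_inr⟩ : C(↥((𝓡∂ (4 + 1)).boundary H), C.W)) 2
            (singularHomology.map ℤ ℤ (⟨g, g.continuous⟩ : C(↥((𝓡∂ (4 + 1)).boundary H), ↥((𝓡∂ (4 + 1)).boundary H))) 2 y))) :=
        congrArg (fun t => singularHomology.map ℤ ℤ At.jWC 2 (singularHomology.map ℤ ℤ At₀.jXC 2 t)) hn
    _ = singularHomology.map ℤ ℤ At.jWC 2 (singularHomology.map ℤ ℤ At₀.jWC 2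
          (singularHomology.map ℤ ℤ
            (⟨Subtype.val, continuous_subtype_val⟩ : C(↥((𝓡∂ (4 + 1)).boundary H), H)) 2 y)) :=
        congrArg (fun t => singularHomology.map ℤ ℤ At.jWC 2 t) e2
    _ = singularHomology.map ℤ ℤ At.jWC 2 (singularHomology.map ℤ ℤ At₀.jWC 2 0) :=
        congrArg (fun t => singularHomology.map ℤ ℤ At.jWC 2 (singularHomology.map ℤ ℤ At₀.jWC 2 t)) hy
    _ = 0 := by simp only [map_zero]

end Regluing

/-! ### Theorem 2 from Thm. 1, Lemma 2, the realisation on `∂V`, and the merging cobordism -/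

section Assembly

/-- **Wall's Theorem 2 for ONE pair, from the four inputs, with Thm. 1 used only in the rank it
is needed** (1964, §2 pp. 144–146): for closed smooth simply connected `M₁`, `M₂` with
`ℤ`-orientations `μ`, `ν` and isometric intersection forms, `M₁` and `M₂` are h-cobordant, GIVEN
Lemma 2 (`hL2`), the realisation on `∂V` (`hreal`), the merging cobordism (`hmerge`) and Wall's
Thm. 1 (`hT1`) for those `N` only whose lattice `H²(N; ℤ)/T` has rank
`rank H²(M₁)/T + rank H²(M₂)/T` — the rank of `N = M₁ # (−M₂)`, to which alone the proof applies
Thm. 1 (the splitting `H²(N)/T ≅ H²(M₁)/T ⊕ H²(M₂)/T` of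
`ConnectedSumNeck.exists_decomposition_intersectionForm` is bijective). This is the form in which
Wall's order of proof is af-cyclic (p. 143: Thm. 1 is proved on pp. 142–143 for rank `≥ 4` and
rank `0`, and for rank `2` only on p. 146 THROUGH Thm. 2 for `rank H₂(Mᵢ) ≠ 1`; p. 146: "observe
that the proof of Theorem 2 is now valid in the case (previously exceptional) when the rank of
`H₂(M₁)` is unity"); see `isHCobordant_of_constructions_of_finrank_ne_one`. The proof is that of
`isHCobordant_of_equivalent_intersectionForm_of_constructions` below, sentence by sentence.
[cite: WallJLMS1964, Thm. 2 and §2 pp. 144–146; p. 143 and p. 146 (ranks)] -/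
theorem isHCobordant_of_constructions_pair
    (M₁ M₂ : Type) [TopologicalSpace M₁] [T2Space M₁] [SecondCountableTopology M₁]
    [ChartedSpace (𝔼 4) M₁] [CompactSpace M₁] [IsManifold (𝓡 4) ∞ M₁] [SimplyConnectedSpace M₁]
    [TopologicalSpace M₂] [T2Space M₂] [SecondCountableTopology M₂]
    [ChartedSpace (𝔼 4) M₂] [CompactSpace M₂] [IsManifold (𝓡 4) ∞ M₂] [SimplyConnectedSpace M₂]
    (μ : HomologicalOrientation ℤ M₁ 4) (ν : HomologicalOrientation ℤ M₂ 4)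
    (hT1 : ∀ (N : Type) [TopologicalSpace N] [T2Space N] [SecondCountableTopology N]
      [ChartedSpace (𝔼 4) N] [CompactSpace N] [IsManifold (𝓡 4) ∞ N] [SimplyConnectedSpace N]
      (π : HomologicalOrientation ℤ N 4), π.signature = 0 →
      Module.finrank ℤ ↥(freeCohomology ℤ N 2) =
        Module.finrank ℤ ↥(freeCohomology ℤ M₁ 2) + Module.finrank ℤ ↥(freeCohomology ℤ M₂ 2) →
      ∃ c : NullCobordism.{0} 4 N, SimplyConnectedSpace c.W ∧
        (∀ k : ℕ, 3 ≤ k → IsZero (singularHomology ℤ ℤ c.W k)) ∧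
        Module.Free ℤ (singularHomology ℤ ℤ c.W 2) ∧ Module.Finite ℤ (singularHomology ℤ ℤ c.W 2))
    (hL2 : exists_handlebody_isHCobordant_boundary)
    (hreal : ∀ (V : Type) [TopologicalSpace V] [T2Space V] [SecondCountableTopology V]
      [ChartedSpace (EuclideanHalfSpace (4 + 1)) V] [IsManifold (𝓡∂ (4 + 1)) ∞ V] [CompactSpace V]
      (k : ℕ), HasHandleDecomposition 4 V (twoHandlebodyCount k) →
      ∀ (β : HomologicalOrientation ℤ ((𝓡∂ (4 + 1)).boundary V) 4)
        (A : (Q⟦β⟧).IsometryEquiv (Q⟦β⟧)), IsRealisedByDiffeomorph β A)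
    (hmerge : ∀ (M₁ M₂ N : Type) [TopologicalSpace M₁] [T2Space M₁] [SecondCountableTopology M₁]
      [ChartedSpace (𝔼 4) M₁] [IsManifold (𝓡 4) ∞ M₁] [CompactSpace M₁] [SimplyConnectedSpace M₁]
      [TopologicalSpace M₂] [T2Space M₂] [SecondCountableTopology M₂]
      [ChartedSpace (𝔼 4) M₂] [IsManifold (𝓡 4) ∞ M₂] [CompactSpace M₂] [SimplyConnectedSpace M₂]
      [TopologicalSpace N] [T2Space N] [SecondCountableTopology N]
      [ChartedSpace (𝔼 4) N] [IsManifold (𝓡 4) ∞ N] [CompactSpace N] [SimplyConnectedSpace N]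
      (d : ConnectedSumNeck 4 M₁ M₂ N),
      Manifold.IsSmoothEmbedding (𝓡 4) (𝓡 4) ∞ d.i₁ → Manifold.IsSmoothEmbedding (𝓡 4) (𝓡 4) ∞ d.i₂ →
      Manifold.IsSmoothEmbedding (𝓡 4) (𝓡 4) ∞ d.jA → Manifold.IsSmoothEmbedding (𝓡 4) (𝓡 4) ∞ d.jB →
      ∃ (W₀ : Cobordism 4 N (M₁ ⊕ M₂)) (_ : SimplyConnectedSpace W₀.W)
        (i₁ : singularHomology ℤ ℤ M₁ 2 →ₗ[ℤ] singularHomology ℤ ℤ N 2)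
        (i₂ : singularHomology ℤ ℤ M₂ 2 →ₗ[ℤ] singularHomology ℤ ℤ N 2),
        Epi (singularHomology.map ℤ ℤ (⟨W₀.inl, W₀.continuous_inl⟩ : C(N, W₀.W)) 2) ∧
        (∀ z, singularHomology.map ℤ ℤ d.collapseLeft 2 (i₁ z) = z) ∧
        (∀ z, singularHomology.map ℤ ℤ d.collapseRight 2 (i₁ z) = 0) ∧
        (∀ z, singularHomology.map ℤ ℤ d.collapseLeft 2 (i₂ z) = 0) ∧
        (∀ z, singularHomology.map ℤ ℤ d.collapseRight 2 (i₂ z) = z) ∧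
        (∀ z, singularHomology.map ℤ ℤ (⟨W₀.inl, W₀.continuous_inl⟩ : C(N, W₀.W)) 2 (i₁ z) =
          singularHomology.map ℤ ℤ (⟨W₀.inr ∘ Sum.inl, W₀.continuous_inr.comp continuous_inl⟩ :
            C(M₁, W₀.W)) 2 z) ∧
        (∀ z, singularHomology.map ℤ ℤ (⟨W₀.inl, W₀.continuous_inl⟩ : C(N, W₀.W)) 2 (i₂ z) =
          singularHomology.map ℤ ℤ (⟨W₀.inr ∘ Sum.inr, W₀.continuous_inr.comp continuous_inr⟩ :
            C(M₂, W₀.W)) 2 z))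
    (h : (Q⟦μ⟧).Equivalent (Q⟦ν⟧)) : IsHCobordant 4 M₁ M₂ := by
  classical
  obtain ⟨α⟩ := h
  -- "Form the connected sum `N = M₁ # (−M₂)`. Since the signatures … that of `N` is zero."
  obtain ⟨N, i1, i2, i3, i4, i5, i6, i7, o₁, o₂, oN, π, hsum, ho₁, ho₂, hπ⟩ :=
    exists_isOrientedConnectedSum_neg_isCompatible (n := 4) (by norm_num) M₁ M₂
      (HomologicalOrientationOfSmooth.μE 4) μ ν
  -- the gluing data of `N`, with its SMOOTH disc and gluing maps (kept for the merging step)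
  obtain ⟨i₁, i₂, _, jA, jB, hi₁, hi₂, -, -, ⟨hjA, hAo, hjB, hBo, hUn, hRel⟩, hoA, hoB⟩ := hsum
  let d : ConnectedSumNeck 4 M₁ M₂ N :=
    { i₁ := i₁
      i₂ := i₂
      jA := jA
      jB := jB
      continuous_i₁ := hi₁.isEmbedding.continuous
      injective_i₁ := hi₁.isEmbedding.injective
      continuous_i₂ := hi₂.isEmbedding.continuous
      injective_i₂ := hi₂.isEmbedding.injective
      isEmbedding_jA := hjA.isEmbedding
      isEmbedding_jB := hjB.isEmbedding
      isOpen_range_jA := hAo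
      isOpen_range_jB := hBo
      union_range := hUn
      rel := hRel }
  have hL : d.IsOrientedLeft μ π :=
    d.isOrientedLeft_of_isOrientationPreserving hjA (HomologicalOrientationOfSmooth.μE 4) ho₁ hπ hoA
  have hR : d.IsOrientedRight (-ν) π :=
    d.isOrientedRight_of_isOrientationPreserving hjB (HomologicalOrientationOfSmooth.μE 4) ho₂ hπ hoB
  obtain ⟨sM, sN, hd1, hd2, hd3, hst, hQ'⟩ :=
    d.exists_decomposition_intersectionForm (m := 3) (by norm_num) (k := 2) (by norm_num)
      two_add_two_eq_four hL hR
  have hQ : ∀ x y, Q⟦π⟧ x y = Q⟦μ⟧ (sM x) (sM y) - Q⟦ν⟧ (sN x) (sN y) := fun x y => by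
    refine (hQ' x y).trans ?_
    show intersectionForm two_add_two_eq_four μ (sM x) (sM y) +
        intersectionForm two_add_two_eq_four (-ν) (sN x) (sN y) = _
    rw [intersectionForm_neg (HomologicalOrientation.fundamentalClass_neg_holds ℤ M₂ 4)
      two_add_two_eq_four ν, LinearMap.neg_apply, LinearMap.neg_apply, sub_eq_add_neg]
  have hσ : π.signature = 0 := signature_eq_zero_of_decomposition hst hQ ⟨α⟩
  -- `rank H²(N)/T = rank H²(M₁)/T + rank H²(M₂)/T` (the lattice splitting is bijective)
  have hrankN : Module.finrank ℤ ↥(freeCohomology ℤ N 2) =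
      Module.finrank ℤ ↥(freeCohomology ℤ M₁ 2) + Module.finrank ℤ ↥(freeCohomology ℤ M₂ 2) := by
    obtain ⟨hfin₁, hfree₁⟩ := finite_and_free_freeCohomology_two (M := M₁)
    obtain ⟨hfin₂, hfree₂⟩ := finite_and_free_freeCohomology_two (M := M₂)
    haveI := hfin₁; haveI := hfree₁; haveI := hfin₂; haveI := hfree₂
    -- pin the `ℤ`-module structure of the product (instance diamond with `toIntModule`)
    letI : Module ℤ (↥(freeCohomology ℤ M₁ 2) × ↥(freeCohomology ℤ M₂ 2)) := Prod.instModule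
    have e := (LinearEquiv.ofBijective (sM.prod sN) hst).finrank_eq
    rw [Module.finrank_prod] at e
    exact e
  -- Thm. 1 and Lemma 2: `V` (here `H`) and the h-cobordism `C : N ∼ ∂V`
  obtain ⟨c₀, hc₀, hc₀3, hc₀free, hc₀fin⟩ := hT1 N π hσ hrankN
  obtain ⟨H, k1, k2, k3, k4, k5, k6, hH, hHC⟩ := hL2 N c₀ hc₀ hc₀3 hc₀free hc₀fin
  obtain ⟨C, hC⟩ := hHC
  set kk : ℕ := Module.finrank ℤ (singularHomology ℤ ℤ c₀.W 2) with hkk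
  -- `∂V`: compact, simply connected, `ℤ`-oriented; `V`: simply connected, `H₂(∂V) → H₂(V)` onto
  haveI : CompactSpace ((𝓡∂ (4 + 1)).boundary H) := compactSpace_boundary 4 H
  haveI : SimplyConnectedSpace C.W := hC.simplyConnectedSpace
  haveI : SimplyConnectedSpace ((𝓡∂ (4 + 1)).boundary H) :=
    hC.simplyConnectedSpace_iff_right.1 inferInstance
  obtain ⟨β⟩ := isOrientableOver_of_simplyConnectedSpace ℤ (↥((𝓡∂ (4 + 1)).boundary H)) (n := 4)
  haveI : SimplyConnectedSpace H := simplyConnectedSpace_of_hasHandleDecomposition_twoHandlebodyCount hH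
  have hepi := epi_map_boundary_two_of_hasHandleDecomposition H hH β
  haveI : Module.Free ℤ (singularHomology ℤ ℤ H 2) :=
    free_singularHomology_two_of_hasHandleDecomposition H hH
  -- the lattices are finitely generated free
  obtain ⟨hfin₁, hfree₁⟩ := finite_and_free_freeCohomology_two (M := M₁)
  obtain ⟨hfin₂, hfree₂⟩ := finite_and_free_freeCohomology_two (M := M₂)
  obtain ⟨hfind, hfreed⟩ := finite_and_free_freeCohomology_two (M := ↥((𝓡∂ (4 + 1)).boundary H))
  haveI := hfin₁; haveI := hfree₁; haveI := hfin₂; haveI := hfree₂; haveI := hfind; haveI := hfreed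
  -- `K` transported through `C` is a Lagrangian direct summand of half rank of `H²(∂V)/T`
  obtain ⟨gq, hgq, hK'c, hK'i, hK'r⟩ :=
    hC.exists_homotopyEquiv_lagrangian_graph_map μ ν π β hst hQ α
  -- "there is a diffeomorphism of `∂V` which induces this isomorphism": `g^*(K') = L`
  have hU : (Q⟦β⟧).IsUnimodular :=
    isPerfPair_intersectionForm_four_of_compactSpace (M := ↥((𝓡∂ (4 + 1)).boundary H)) β
  obtain ⟨g, hgK⟩ := exists_diffeomorph_map_eq_range_of_isotropic
    isotropic_range_map_boundary_of_hasHandleDecomposition_holds H kk hH β hU (hreal H kk hH β)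
    _ hK'c hK'i hK'r
  -- the neck-filling cobordism `W₀`
  obtain ⟨W₀, hW₀, ι₁, ι₂, hW₀epi, hi₁s, hi₁t, hi₂s, hi₂t, hi₁W, hi₂W⟩ :=
    hmerge M₁ M₂ N d hi₁ hi₂ hjA hjB
  -- the re-gluing `R`
  obtain ⟨Rc, hRsc, J, hJ, hinl, hinr, hvan⟩ := exists_regluing_cobordism H hepi C hC g W₀
  -- "Now we calculate what has happened to the second homology group"
  haveI := isPerfPair_freeKroneckerPairing_two N
  haveI := isPerfPair_freeKroneckerPairing_two M₁
  haveI := isPerfPair_freeKroneckerPairing_two M₂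
  haveI := isPerfPair_freeKroneckerPairing_two (↥((𝓡∂ (4 + 1)).boundary H))
  -- the homological transport `Φ_h = inl_*⁻¹ ∘ inr_*` through `C`
  haveI := hC.isIso_map_inl 2
  haveI := hC.isIso_map_inr 2
  let EInl : singularHomology ℤ ℤ N 2 ≃ₗ[ℤ] singularHomology ℤ ℤ C.W 2 :=
    (asIso (singularHomology.map ℤ ℤ (⟨C.inl, C.continuous_inl⟩ : C(N, C.W)) 2)).toLinearEquiv
  let EInr : singularHomology ℤ ℤ ((𝓡∂ (4 + 1)).boundary H) 2 ≃ₗ[ℤ] singularHomology ℤ ℤ C.W 2 :=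
    (asIso (singularHomology.map ℤ ℤ (⟨C.inr, C.continuous_inr⟩ : C(↥((𝓡∂ (4 + 1)).boundary H), C.W)) 2)).toLinearEquiv
  have hEInl : ∀ x, EInl x =
      singularHomology.map ℤ ℤ (⟨C.inl, C.continuous_inl⟩ : C(N, C.W)) 2 x := fun x => rfl
  have hEInr : ∀ y, EInr y =
      singularHomology.map ℤ ℤ (⟨C.inr, C.continuous_inr⟩ : C(↥((𝓡∂ (4 + 1)).boundary H), C.W)) 2 y := fun y => rfl
  let Φh : singularHomology ℤ ℤ ((𝓡∂ (4 + 1)).boundary H) 2 →ₗ[ℤ] singularHomology ℤ ℤ N 2 :=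
    EInl.symm.toLinearMap ∘ₗ EInr.toLinearMap
  let Ψh : singularHomology ℤ ℤ N 2 →ₗ[ℤ] singularHomology ℤ ℤ ((𝓡∂ (4 + 1)).boundary H) 2 :=
    EInr.symm.toLinearMap ∘ₗ EInl.toLinearMap
  have hΦΨ : ∀ x, Φh (Ψh x) = x := fun x => by simp [Φh, Ψh]
  have hΨΦ : ∀ y, Ψh (Φh y) = y := fun y => by simp [Φh, Ψh]
  have hΦinl : ∀ y, singularHomology.map ℤ ℤ (⟨C.inl, C.continuous_inl⟩ : C(N, C.W)) 2 (Φh y) =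
      singularHomology.map ℤ ℤ (⟨C.inr, C.continuous_inr⟩ : C(↥((𝓡∂ (4 + 1)).boundary H), C.W)) 2 y := fun y => by
    rw [← hEInl, ← hEInr]
    simp [Φh]
  -- `C.inl^*` is onto on `H²/T` (a homotopy equivalence)
  have hinlsurj : Surjective (freeCohomology.map (R := ℤ)
      (⟨C.inl, C.continuous_inl⟩ : C(N, C.W)) 2) := by
    obtain ⟨e₁, he₁⟩ := hC.1
    have hfun : (⟨C.inl, C.continuous_inl⟩ : C(N, C.W)) = e₁.toFun := by
      ext x; exact (congrFun he₁ x).symm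
    rw [hfun]
    exact (freeCohomology_bijective_map_of_homotopyEquiv e₁ 2).2
  -- adjointness of `Φ_c = gq^*` and `Φ_h`
  have hΦ : ∀ w y, freeKroneckerPairing N 2 w (Φh y) =
      freeKroneckerPairing _ 2 (freeCohomology.map (R := ℤ) gq.toFun 2 w) y := fun w y => by
    obtain ⟨a, rfl⟩ := hinlsurj w
    rw [freeKroneckerPairing_map, hΦinl, ← freeKroneckerPairing_map, hgq 2 a]
  have hΦc : Injective (freeCohomology.map (R := ℤ) gq.toFun 2) :=
    (freeCohomology_bijective_map_of_homotopyEquiv gq 2).1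
  -- the diffeomorphism `g` in cohomology and homology
  have hgc : Injective (freeCohomology.map (R := ℤ)
      (⟨g, g.continuous⟩ : C(↥((𝓡∂ (4 + 1)).boundary H), ↥((𝓡∂ (4 + 1)).boundary H))) 2) :=
    fun x y hxy => by
      have h' := congrArg (freeCohomology.map (R := ℤ)
        (⟨g.symm, g.symm.continuous⟩ : C(↥((𝓡∂ (4 + 1)).boundary H), ↥((𝓡∂ (4 + 1)).boundary H))) 2) hxy
      rwa [freeCohomologyMap_symm_apply_map, freeCohomologyMap_symm_apply_map] at h'
  have hgsymm : (⟨g, g.continuous⟩ : C(↥((𝓡∂ (4 + 1)).boundary H), ↥((𝓡∂ (4 + 1)).boundary H))).comp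
      (⟨g.symm, g.symm.continuous⟩ : C(↥((𝓡∂ (4 + 1)).boundary H), ↥((𝓡∂ (4 + 1)).boundary H))) = ContinuousMap.id _ :=
    ContinuousMap.ext fun y => g.apply_symm_apply y
  have hsymmg : (⟨g.symm, g.symm.continuous⟩ : C(↥((𝓡∂ (4 + 1)).boundary H), ↥((𝓡∂ (4 + 1)).boundary H))).comp
      (⟨g, g.continuous⟩ : C(↥((𝓡∂ (4 + 1)).boundary H), ↥((𝓡∂ (4 + 1)).boundary H))) = ContinuousMap.id _ :=
    ContinuousMap.ext fun y => g.symm_apply_apply y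
  have hgg' : ∀ y, (singularHomology.map ℤ ℤ (⟨g, g.continuous⟩ : C(↥((𝓡∂ (4 + 1)).boundary H), ↥((𝓡∂ (4 + 1)).boundary H))) 2).hom
      ((singularHomology.map ℤ ℤ (⟨g.symm, g.symm.continuous⟩ : C(↥((𝓡∂ (4 + 1)).boundary H), ↥((𝓡∂ (4 + 1)).boundary H))) 2).hom y) = y := fun y => by
    change (singularHomology.map ℤ ℤ _ 2 ≫ singularHomology.map ℤ ℤ _ 2) y = y
    rw [← singularHomology.map_comp, hgsymm, singularHomology.map_id]; rfl
  have hg'g : ∀ y, (singularHomology.map ℤ ℤ (⟨g.symm, g.symm.continuous⟩ : C(↥((𝓡∂ (4 + 1)).boundary H), ↥((𝓡∂ (4 + 1)).boundary H))) 2).hom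
      ((singularHomology.map ℤ ℤ (⟨g, g.continuous⟩ : C(↥((𝓡∂ (4 + 1)).boundary H), ↥((𝓡∂ (4 + 1)).boundary H))) 2).hom y) = y := fun y => by
    change (singularHomology.map ℤ ℤ _ 2 ≫ singularHomology.map ℤ ℤ _ 2) y = y
    rw [← singularHomology.map_comp, hsymmg, singularHomology.map_id]; rfl
  -- the geometric map `F = jX_* ∘ inl₀_* : H₂(N) → H₂(R)`
  let F : singularHomology ℤ ℤ N 2 →ₗ[ℤ] singularHomology ℤ ℤ Rc.W 2 :=
    (singularHomology.map ℤ ℤ J 2).hom ∘ₗ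
      (singularHomology.map ℤ ℤ (⟨W₀.inl, W₀.continuous_inl⟩ : C(N, W₀.W)) 2).hom
  have hF : Surjective F :=
    ((ModuleCat.epi_iff_surjective _).1 hJ).comp ((ModuleCat.epi_iff_surjective _).1 hW₀epi)
  have hvanF : ∀ y, (singularHomology.map ℤ ℤ
      (⟨Subtype.val, continuous_subtype_val⟩ : C(↥((𝓡∂ (4 + 1)).boundary H), H)) 2).hom y = 0 →
      F (Φh ((singularHomology.map ℤ ℤ (⟨g, g.continuous⟩ : C(↥((𝓡∂ (4 + 1)).boundary H), ↥((𝓡∂ (4 + 1)).boundary H))) 2).hom y)) = 0 :=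
    fun y hy => hvan y _ hy (hΦinl _)
  -- the computation
  obtain ⟨hS₁, hS₂⟩ := surjective_comp_of_wall_lattice_data
    (freeKroneckerPairing N 2) (freeKroneckerPairing M₁ 2) (freeKroneckerPairing M₂ 2)
    (freeKroneckerPairing (↥((𝓡∂ (4 + 1)).boundary H)) 2) (freeKroneckerPairing H 2)
    freeKroneckerPairing_surjective
    (cMc := freeCohomology.map (R := ℤ) d.collapseLeft 2)
    (cNc := freeCohomology.map (R := ℤ) d.collapseRight 2) (sM := sM) (sN := sN)
    (sh := (singularHomology.map ℤ ℤ d.collapseLeft 2).hom)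
    (th := (singularHomology.map ℤ ℤ d.collapseRight 2).hom)
    (fun a x => freeKroneckerPairing_map d.collapseLeft a x)
    (fun b x => freeKroneckerPairing_map d.collapseRight b x) hd1 hd2 hd3
    (α := (α : freeCohomology ℤ M₁ 2 →ₗ[ℤ] freeCohomology ℤ M₂ 2)) α.toLinearEquiv.bijective
    (Φc := freeCohomology.map (R := ℤ) gq.toFun 2) (Φh := Φh) (Ψh := Ψh) hΦ hΦc hΦΨ hΨΦ
    (gc := freeCohomology.map (R := ℤ) (⟨g, g.continuous⟩ : C(↥((𝓡∂ (4 + 1)).boundary H), ↥((𝓡∂ (4 + 1)).boundary H))) 2)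
    (gh := (singularHomology.map ℤ ℤ (⟨g, g.continuous⟩ : C(↥((𝓡∂ (4 + 1)).boundary H), ↥((𝓡∂ (4 + 1)).boundary H))) 2).hom)
    (gh' := (singularHomology.map ℤ ℤ (⟨g.symm, g.symm.continuous⟩ : C(↥((𝓡∂ (4 + 1)).boundary H), ↥((𝓡∂ (4 + 1)).boundary H))) 2).hom)
    (fun a y => freeKroneckerPairing_map _ a y) hgc hgg' hg'g
    (ιh := (singularHomology.map ℤ ℤ
      (⟨Subtype.val, continuous_subtype_val⟩ : C(↥((𝓡∂ (4 + 1)).boundary H), H)) 2).hom)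
    ((ModuleCat.epi_iff_surjective _).1 hepi)
    (ιc := freeCohomology.map (R := ℤ)
      (⟨Subtype.val, continuous_subtype_val⟩ : C(↥((𝓡∂ (4 + 1)).boundary H), H)) 2)
    (fun b y => freeKroneckerPairing_map _ b y) hgK (F := F) hF hvanF
    (i₁ := ι₁) hi₁s hi₁t (i₂ := ι₂) hi₂s hi₂t
  -- the ends of `R` on `H₂`: `inl_* = F ∘ i₁`, `inr_* = F ∘ i₂`, both onto
  haveI : SimplyConnectedSpace Rc.W := hRsc
  have hM : Epi (singularHomology.map ℤ ℤ (⟨Rc.inl, Rc.continuous_inl⟩ : C(M₁, Rc.W)) 2) := by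
    rw [ModuleCat.epi_iff_surjective]
    intro x
    obtain ⟨z, rfl⟩ := hS₁ x
    refine ⟨z, ?_⟩
    rw [hinl, singularHomology.map_comp, ModuleCat.comp_apply, ← hi₁W]
    rfl
  have hN : Epi (singularHomology.map ℤ ℤ (⟨Rc.inr, Rc.continuous_inr⟩ : C(M₂, Rc.W)) 2) := by
    rw [ModuleCat.epi_iff_surjective]
    intro x
    obtain ⟨z, rfl⟩ := hS₂ x
    refine ⟨z, ?_⟩
    rw [hinr, singularHomology.map_comp, ModuleCat.comp_apply, ← hi₂W]
    rfl
  -- "Hence `Hₖ(R, Mᵢ) = 0` for `k ≤ 2` … and `R` is indeed an h-cobordism."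
  exact isHCobordant_of_epi_singularHomologyMap_two Rc hM hN

/-- **Wall's Theorem 2 from its four inputs** (1964, Thm. 2 with §2, pp. 144–146). GIVEN
(`hT1`) Wall's Thm. 1 — a closed smooth simply connected 4-manifold with a `ℤ`-orientation of
signature `0` bounds a compact simply connected `W⁵` with `Hₖ(W) = 0` (`k ≥ 3`) and `H₂(W)`
finitely generated free —, (`hL2`) Wall's Lemma 2 in the tree's form
`exists_handlebody_isHCobordant_boundary`, (`hreal`) "the result quoted above": every automorph
of the intersection form of the boundary of a handlebody `V ∈ ℋ(5, k, 2)` is realised by a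
diffeomorphism ([10] with [11], Cor. to Thm. 2), and (`hmerge`) the merging cobordism
`W₀ : M₁ # M₂ ∼ M₁ ⊔ M₂` with its homology (simply connected, `H₂(N) → H₂(W₀)` onto, the bottom
copies inducing the summand inclusions of `H₂(N) ≅ H₂(M₁) ⊕ H₂(M₂)` — Kervaire–Milnor 1963
Lemma 2.2, to be discharged from `BordismMerging.lean`), **closed smooth simply connected
4-manifolds with isometric intersection forms are h-cobordant**
(`isHCobordant_of_equivalent_intersectionForm`). PROOF, following §2 sentence by sentence:
`N = M₁ # (−M₂)` with `σ(N) = 0` and the lattice splitting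
(`exists_isOrientedConnectedSum_neg_isCompatible`, `ConnectedSumNeck.exists_decomposition_intersectionForm`,
`signature_eq_zero_of_decomposition`); Thm. 1, Lemma 2: `V`, `C`; `∂V` simply connected and
`ℤ`-oriented; `K` transported through `C` is a Lagrangian summand of half rank
(`Cobordism.IsHCobordism.exists_homotopyEquiv_lagrangian_graph_map`), and so is `L`
(`isotropic_range_map_boundary_of_hasHandleDecomposition_holds`); the re-gluing diffeomorphism
`g` with `g^*(K') = L` (`exists_diffeomorph_map_eq_range_of_isotropic`, fed by `hreal`);
`R = (V ∪_g C) ∪_N W₀` simply connected with `H₂(W₀) → H₂(R)` onto (`exists_regluing_cobordism`,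
the handlebody facts `simplyConnectedSpace_of_hasHandleDecomposition_twoHandlebodyCount`,
`epi_map_boundary_two_of_hasHandleDecomposition`); `H₂(Mᵢ) → H₂(R)` onto
(`surjective_comp_of_wall_lattice_data` across the Kronecker pairings of
`KroneckerFreeCohomology.lean`); "Hence … `R` is indeed an h-cobordism"
(`isHCobordant_of_epi_singularHomologyMap_two`). [cite: WallJLMS1964, Thm. 2 and §2 pp. 144–146] -/
theorem isHCobordant_of_equivalent_intersectionForm_of_constructions
    (hT1 : ∀ (N : Type) [TopologicalSpace N] [T2Space N] [SecondCountableTopology N]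
      [ChartedSpace (𝔼 4) N] [CompactSpace N] [IsManifold (𝓡 4) ∞ N] [SimplyConnectedSpace N]
      (π : HomologicalOrientation ℤ N 4), π.signature = 0 →
      ∃ c : NullCobordism.{0} 4 N, SimplyConnectedSpace c.W ∧
        (∀ k : ℕ, 3 ≤ k → IsZero (singularHomology ℤ ℤ c.W k)) ∧
        Module.Free ℤ (singularHomology ℤ ℤ c.W 2) ∧ Module.Finite ℤ (singularHomology ℤ ℤ c.W 2))
    (hL2 : exists_handlebody_isHCobordant_boundary)
    (hreal : ∀ (V : Type) [TopologicalSpace V] [T2Space V] [SecondCountableTopology V]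
      [ChartedSpace (EuclideanHalfSpace (4 + 1)) V] [IsManifold (𝓡∂ (4 + 1)) ∞ V] [CompactSpace V]
      (k : ℕ), HasHandleDecomposition 4 V (twoHandlebodyCount k) →
      ∀ (β : HomologicalOrientation ℤ ((𝓡∂ (4 + 1)).boundary V) 4)
        (A : (Q⟦β⟧).IsometryEquiv (Q⟦β⟧)), IsRealisedByDiffeomorph β A)
    (hmerge : ∀ (M₁ M₂ N : Type) [TopologicalSpace M₁] [T2Space M₁] [SecondCountableTopology M₁]
      [ChartedSpace (𝔼 4) M₁] [IsManifold (𝓡 4) ∞ M₁] [CompactSpace M₁] [SimplyConnectedSpace M₁]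
      [TopologicalSpace M₂] [T2Space M₂] [SecondCountableTopology M₂]
      [ChartedSpace (𝔼 4) M₂] [IsManifold (𝓡 4) ∞ M₂] [CompactSpace M₂] [SimplyConnectedSpace M₂]
      [TopologicalSpace N] [T2Space N] [SecondCountableTopology N]
      [ChartedSpace (𝔼 4) N] [IsManifold (𝓡 4) ∞ N] [CompactSpace N] [SimplyConnectedSpace N]
      (d : ConnectedSumNeck 4 M₁ M₂ N),
      Manifold.IsSmoothEmbedding (𝓡 4) (𝓡 4) ∞ d.i₁ → Manifold.IsSmoothEmbedding (𝓡 4) (𝓡 4) ∞ d.i₂ →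
      Manifold.IsSmoothEmbedding (𝓡 4) (𝓡 4) ∞ d.jA → Manifold.IsSmoothEmbedding (𝓡 4) (𝓡 4) ∞ d.jB →
      ∃ (W₀ : Cobordism 4 N (M₁ ⊕ M₂)) (_ : SimplyConnectedSpace W₀.W)
        (i₁ : singularHomology ℤ ℤ M₁ 2 →ₗ[ℤ] singularHomology ℤ ℤ N 2)
        (i₂ : singularHomology ℤ ℤ M₂ 2 →ₗ[ℤ] singularHomology ℤ ℤ N 2),
        Epi (singularHomology.map ℤ ℤ (⟨W₀.inl, W₀.continuous_inl⟩ : C(N, W₀.W)) 2) ∧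
        (∀ z, singularHomology.map ℤ ℤ d.collapseLeft 2 (i₁ z) = z) ∧
        (∀ z, singularHomology.map ℤ ℤ d.collapseRight 2 (i₁ z) = 0) ∧
        (∀ z, singularHomology.map ℤ ℤ d.collapseLeft 2 (i₂ z) = 0) ∧
        (∀ z, singularHomology.map ℤ ℤ d.collapseRight 2 (i₂ z) = z) ∧
        (∀ z, singularHomology.map ℤ ℤ (⟨W₀.inl, W₀.continuous_inl⟩ : C(N, W₀.W)) 2 (i₁ z) =
          singularHomology.map ℤ ℤ (⟨W₀.inr ∘ Sum.inl, W₀.continuous_inr.comp continuous_inl⟩ :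
            C(M₁, W₀.W)) 2 z) ∧
        (∀ z, singularHomology.map ℤ ℤ (⟨W₀.inl, W₀.continuous_inl⟩ : C(N, W₀.W)) 2 (i₂ z) =
          singularHomology.map ℤ ℤ (⟨W₀.inr ∘ Sum.inr, W₀.continuous_inr.comp continuous_inr⟩ :
            C(M₂, W₀.W)) 2 z)) :
    isHCobordant_of_equivalent_intersectionForm := by
  intro M₁ M₂ _ _ _ _ _ _ _ _ _ _ _ _ _ _ μ ν h
  exact isHCobordant_of_constructions_pair M₁ M₂ μ ν (fun N _ _ _ _ _ _ _ π hσ _ => hT1 N π hσ)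
    hL2 hreal hmerge h

/-- **Wall's Theorem 2 for `rank H₂(M₁) ≠ 1` from Thm. 1 for rank `≠ 2`** (the af-cyclic first
stage of Wall's order of proof, p. 143 and p. 146): GIVEN Thm. 1 for the closed simply connected
4-manifolds of signature `0` whose lattice `H²(−; ℤ)/T` has rank `≠ 2` (`hT1r` — rank `≥ 4` is
pp. 142–143, rank `0` is Wall's ref. [9]), Lemma 2, the realisation on `∂V` and the merging
cobordism, two closed smooth simply connected 4-manifolds with isometric intersection forms and
`rank H²(M₁; ℤ)/T ≠ 1` are h-cobordant: `N = M₁ # (−M₂)` has rank `2 · rank H²(M₁)/T ≠ 2`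
(`isHCobordant_of_constructions_pair`; isometric forms have equal rank). The remaining case
`rank = 1` is Wall's last paragraph of §2 (Thm. 1 for rank `2` through this theorem applied to
`(M, S)` or `(M, T)`, then the same construction). [cite: WallJLMS1964, §2 p. 146; Thm. 1 p. 142 and p. 143] -/
theorem isHCobordant_of_constructions_of_finrank_ne_one
    (hT1r : ∀ (N : Type) [TopologicalSpace N] [T2Space N] [SecondCountableTopology N]
      [ChartedSpace (𝔼 4) N] [CompactSpace N] [IsManifold (𝓡 4) ∞ N] [SimplyConnectedSpace N]
      (π : HomologicalOrientation ℤ N 4), π.signature = 0 →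
      Module.finrank ℤ ↥(freeCohomology ℤ N 2) ≠ 2 →
      ∃ c : NullCobordism.{0} 4 N, SimplyConnectedSpace c.W ∧
        (∀ k : ℕ, 3 ≤ k → IsZero (singularHomology ℤ ℤ c.W k)) ∧
        Module.Free ℤ (singularHomology ℤ ℤ c.W 2) ∧ Module.Finite ℤ (singularHomology ℤ ℤ c.W 2))
    (hL2 : exists_handlebody_isHCobordant_boundary)
    (hreal : ∀ (V : Type) [TopologicalSpace V] [T2Space V] [SecondCountableTopology V]
      [ChartedSpace (EuclideanHalfSpace (4 + 1)) V] [IsManifold (𝓡∂ (4 + 1)) ∞ V] [CompactSpace V]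
      (k : ℕ), HasHandleDecomposition 4 V (twoHandlebodyCount k) →
      ∀ (β : HomologicalOrientation ℤ ((𝓡∂ (4 + 1)).boundary V) 4)
        (A : (Q⟦β⟧).IsometryEquiv (Q⟦β⟧)), IsRealisedByDiffeomorph β A)
    (hmerge : ∀ (M₁ M₂ N : Type) [TopologicalSpace M₁] [T2Space M₁] [SecondCountableTopology M₁]
      [ChartedSpace (𝔼 4) M₁] [IsManifold (𝓡 4) ∞ M₁] [CompactSpace M₁] [SimplyConnectedSpace M₁]
      [TopologicalSpace M₂] [T2Space M₂] [SecondCountableTopology M₂]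
      [ChartedSpace (𝔼 4) M₂] [IsManifold (𝓡 4) ∞ M₂] [CompactSpace M₂] [SimplyConnectedSpace M₂]
      [TopologicalSpace N] [T2Space N] [SecondCountableTopology N]
      [ChartedSpace (𝔼 4) N] [IsManifold (𝓡 4) ∞ N] [CompactSpace N] [SimplyConnectedSpace N]
      (d : ConnectedSumNeck 4 M₁ M₂ N),
      Manifold.IsSmoothEmbedding (𝓡 4) (𝓡 4) ∞ d.i₁ → Manifold.IsSmoothEmbedding (𝓡 4) (𝓡 4) ∞ d.i₂ →
      Manifold.IsSmoothEmbedding (𝓡 4) (𝓡 4) ∞ d.jA → Manifold.IsSmoothEmbedding (𝓡 4) (𝓡 4) ∞ d.jB →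
      ∃ (W₀ : Cobordism 4 N (M₁ ⊕ M₂)) (_ : SimplyConnectedSpace W₀.W)
        (i₁ : singularHomology ℤ ℤ M₁ 2 →ₗ[ℤ] singularHomology ℤ ℤ N 2)
        (i₂ : singularHomology ℤ ℤ M₂ 2 →ₗ[ℤ] singularHomology ℤ ℤ N 2),
        Epi (singularHomology.map ℤ ℤ (⟨W₀.inl, W₀.continuous_inl⟩ : C(N, W₀.W)) 2) ∧
        (∀ z, singularHomology.map ℤ ℤ d.collapseLeft 2 (i₁ z) = z) ∧
        (∀ z, singularHomology.map ℤ ℤ d.collapseRight 2 (i₁ z) = 0) ∧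
        (∀ z, singularHomology.map ℤ ℤ d.collapseLeft 2 (i₂ z) = 0) ∧
        (∀ z, singularHomology.map ℤ ℤ d.collapseRight 2 (i₂ z) = z) ∧
        (∀ z, singularHomology.map ℤ ℤ (⟨W₀.inl, W₀.continuous_inl⟩ : C(N, W₀.W)) 2 (i₁ z) =
          singularHomology.map ℤ ℤ (⟨W₀.inr ∘ Sum.inl, W₀.continuous_inr.comp continuous_inl⟩ :
            C(M₁, W₀.W)) 2 z) ∧
        (∀ z, singularHomology.map ℤ ℤ (⟨W₀.inl, W₀.continuous_inl⟩ : C(N, W₀.W)) 2 (i₂ z) =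
          singularHomology.map ℤ ℤ (⟨W₀.inr ∘ Sum.inr, W₀.continuous_inr.comp continuous_inr⟩ :
            C(M₂, W₀.W)) 2 z))
    (M₁ M₂ : Type) [TopologicalSpace M₁] [T2Space M₁] [SecondCountableTopology M₁]
    [ChartedSpace (𝔼 4) M₁] [CompactSpace M₁] [IsManifold (𝓡 4) ∞ M₁] [SimplyConnectedSpace M₁]
    [TopologicalSpace M₂] [T2Space M₂] [SecondCountableTopology M₂]
    [ChartedSpace (𝔼 4) M₂] [CompactSpace M₂] [IsManifold (𝓡 4) ∞ M₂] [SimplyConnectedSpace M₂]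
    (μ : HomologicalOrientation ℤ M₁ 4) (ν : HomologicalOrientation ℤ M₂ 4)
    (hr : Module.finrank ℤ ↥(freeCohomology ℤ M₁ 2) ≠ 1) (h : (Q⟦μ⟧).Equivalent (Q⟦ν⟧)) :
    IsHCobordant 4 M₁ M₂ := by
  obtain ⟨α⟩ := id h
  have hr₂ : Module.finrank ℤ ↥(freeCohomology ℤ M₂ 2) = Module.finrank ℤ ↥(freeCohomology ℤ M₁ 2) :=
    α.toLinearEquiv.finrank_eq.symm
  exact isHCobordant_of_constructions_pair M₁ M₂ μ ν
    (fun N _ _ _ _ _ _ _ π hσ hrk => hT1r N π hσ (by rw [hrk, hr₂]; omega)) hL2 hreal hmerge h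

end Assembly

end Literature.Topology.FourManifolds

end
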